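import Summits.AnomalousDissipation.AnomalousDissipation.Theorems.SolenoidalFractalHomogenisationRealisedQuasiStaticCellLawSlavedIsoSectorDecay
import HarnessLib

/-!
# K2R `RealisedQuasiStaticCellLaw`, line `floquet-bloch`, stub `stub_lowSectorDecay` (S1D): calculus of the co-moving
# pair weights (W-near regime) — primitives of the squared slot envelope and elementary `2 × 2` form algebra

Summits-side helper file (everything proved; no definitions, no named facts; `--supports stmt-AnomalousDissipation-20446`).
Elementary inputs of the weight construction feeding `isoSector_decay_ae`: the primitive `r ↦ ∫₀ʳ trapezoid²` (derivative,
values, bounds), the Gram identity turning the joint slow form with weights `(|v₁|², |v₂|², v₁·v₂)` into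
`|ξ₁v₁ + ξ₂v₂|²` on real and imaginary parts, and the one-step expansion / boundedness of the nominal `2 × 2` transport
`N = Rᵀ diag(e₁, e₂) R`, `R` a rotation.
-/

set_option linter.dupNamespace false

noncomputable section

namespace Summit.AnomalousDissipation.AnomalousDissipation.Theorems.SolenoidalFractalHomogenisation.RealisedQuasiStaticCellLaw

open Set MeasureTheory Filter Topology Function Complex
open scoped ComplexConjugate
open Literature.Analysis.FluidPDE Literature.Analysis.FluidPDE.LatticeShear

/-- The trapezoid envelope is continuous. -/
theorem continuous_trapezoid_zero (τ ρ : ℝ) : Continuous fun s => LatticeWord.trapezoid 0 τ ρ s := by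
  unfold LatticeWord.trapezoid; fun_prop

/-- `0 ≤ trapezoid ≤ 1`. -/
theorem trapezoid_zero_mem_Icc (τ ρ s : ℝ) : LatticeWord.trapezoid 0 τ ρ s ∈ Icc (0:ℝ) 1 := by
  unfold LatticeWord.trapezoid
  exact ⟨le_max_left _ _, max_le zero_le_one (min_le_left _ _)⟩

/-- **FTC for the squared envelope**: `r ↦ ∫₀ʳ trapezoid²` has derivative `trapezoid(r)²` everywhere. -/
theorem hasDerivAt_integral_trapezoid_sq (τ ρ r : ℝ) :
    HasDerivAt (fun r => ∫ s in (0:ℝ)..r, LatticeWord.trapezoid 0 τ ρ s ^ 2) (LatticeWord.trapezoid 0 τ ρ r ^ 2) r := by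
  have hc : Continuous fun s => LatticeWord.trapezoid 0 τ ρ s ^ 2 := (continuous_trapezoid_zero τ ρ).pow 2
  exact intervalIntegral.integral_hasDerivAt_right (hc.intervalIntegrable (μ := volume) 0 r)
    (hc.stronglyMeasurableAtFilter volume (𝓝 r)) hc.continuousAt

/-- Monotonicity of the primitive of the squared envelope. -/
theorem integral_trapezoid_sq_mono (τ ρ : ℝ) {a b : ℝ} (hab : a ≤ b) :
    ∫ s in (0:ℝ)..a, LatticeWord.trapezoid 0 τ ρ s ^ 2 ≤ ∫ s in (0:ℝ)..b, LatticeWord.trapezoid 0 τ ρ s ^ 2 := by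
  have hc : Continuous fun s => LatticeWord.trapezoid 0 τ ρ s ^ 2 := (continuous_trapezoid_zero τ ρ).pow 2
  have h := intervalIntegral.integral_add_adjacent_intervals (hc.intervalIntegrable (μ := volume) 0 a)
    (hc.intervalIntegrable (μ := volume) a b)
  have hnn : 0 ≤ ∫ s in a..b, LatticeWord.trapezoid 0 τ ρ s ^ 2 :=
    intervalIntegral.integral_nonneg hab fun s _ => sq_nonneg _
  linarith

/-- `0 ≤ ∫₀ʳ trapezoid² ≤ τ(1 − 4ρ/3)` for `r ∈ [0, τ]`. -/
theorem integral_trapezoid_sq_bounds {τ ρ r : ℝ} (hτ : 0 < τ) (hρ : 0 < ρ) (hρ2 : ρ ≤ 1 / 2) (hr : r ∈ Icc 0 τ) :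
    0 ≤ ∫ s in (0:ℝ)..r, LatticeWord.trapezoid 0 τ ρ s ^ 2 ∧
      ∫ s in (0:ℝ)..r, LatticeWord.trapezoid 0 τ ρ s ^ 2 ≤ τ * (1 - 4 * ρ / 3) := by
  constructor
  · have := integral_trapezoid_sq_mono τ ρ hr.1
    simpa using this
  · rw [← integral_trapezoid_sq hτ hρ hρ2]
    exact integral_trapezoid_sq_mono τ ρ hr.2

/-- **Gram identity for the joint slow form.** With real weights `a = |v₁|², b = |v₂|², c = v₁·v₂` (`v₁, v₂ ∈ ℝ²`) and
complex entries `y₁, y₂`: `a|y₁|² + b|y₂|² + 2Re(c ȳ₁ y₂) = |Re y₁ v₁ + Re y₂ v₂|² + |Im y₁ v₁ + Im y₂ v₂|²`. -/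
theorem pairForm_gram (v₁₁ v₁₂ v₂₁ v₂₂ : ℝ) (y₁ y₂ : ℂ) :
    (v₁₁ ^ 2 + v₁₂ ^ 2) * ‖y₁‖ ^ 2 + (v₂₁ ^ 2 + v₂₂ ^ 2) * ‖y₂‖ ^ 2 +
        2 * ((((v₁₁ * v₂₁ + v₁₂ * v₂₂ : ℝ)) : ℂ) * conj y₁ * y₂).re =
      ((y₁.re * v₁₁ + y₂.re * v₂₁) ^ 2 + (y₁.re * v₁₂ + y₂.re * v₂₂) ^ 2) +
        ((y₁.im * v₁₁ + y₂.im * v₂₁) ^ 2 + (y₁.im * v₁₂ + y₂.im * v₂₂) ^ 2) := by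
  rw [Complex.sq_norm, Complex.sq_norm, Complex.normSq_apply, Complex.normSq_apply]
  simp only [Complex.mul_re, Complex.ofReal_re, Complex.ofReal_im, Complex.conj_re, Complex.conj_im, Complex.mul_im]
  ring

/-- **One transport step is expansive.** If `|Cz|² ≥ |z|²` for all `z` and `N = Rᵀ diag(e₁, e₂) R` with `R = [[p, q],[−q, p]]`,
`p² + q² = 1`, `e₁, e₂ ≥ 1`, then `|C N z|² ≥ |z|²`. -/
theorem transport_step_expansive {c₁₁ c₁₂ c₂₁ c₂₂ p q e₁ e₂ : ℝ} (hpq : p ^ 2 + q ^ 2 = 1) (he₁ : 1 ≤ e₁) (he₂ : 1 ≤ e₂)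
    (hC : ∀ z₁ z₂ : ℝ, z₁ ^ 2 + z₂ ^ 2 ≤ (c₁₁ * z₁ + c₁₂ * z₂) ^ 2 + (c₂₁ * z₁ + c₂₂ * z₂) ^ 2) (z₁ z₂ : ℝ) :
    z₁ ^ 2 + z₂ ^ 2 ≤
      ((c₁₁ * (p ^ 2 * e₁ + q ^ 2 * e₂) + c₁₂ * (p * q * (e₁ - e₂))) * z₁ +
          (c₁₁ * (p * q * (e₁ - e₂)) + c₁₂ * (q ^ 2 * e₁ + p ^ 2 * e₂)) * z₂) ^ 2 +
        ((c₂₁ * (p ^ 2 * e₁ + q ^ 2 * e₂) + c₂₂ * (p * q * (e₁ - e₂))) * z₁ +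
          (c₂₁ * (p * q * (e₁ - e₂)) + c₂₂ * (q ^ 2 * e₁ + p ^ 2 * e₂)) * z₂) ^ 2 := by
  -- `N z = Rᵀ (M (R z))`
  have key : ∀ a b : ℝ, (a * (p ^ 2 * e₁ + q ^ 2 * e₂) + b * (p * q * (e₁ - e₂))) * z₁ +
      (a * (p * q * (e₁ - e₂)) + b * (q ^ 2 * e₁ + p ^ 2 * e₂)) * z₂ =
      a * (p * (e₁ * (p * z₁ + q * z₂)) - q * (e₂ * (-q * z₁ + p * z₂))) +
        b * (q * (e₁ * (p * z₁ + q * z₂)) + p * (e₂ * (-q * z₁ + p * z₂))) := by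
    intro a b; ring
  rw [key, key]
  have h1 := hC (p * (e₁ * (p * z₁ + q * z₂)) - q * (e₂ * (-q * z₁ + p * z₂)))
    (q * (e₁ * (p * z₁ + q * z₂)) + p * (e₂ * (-q * z₁ + p * z₂)))
  have hn : (p * (e₁ * (p * z₁ + q * z₂)) - q * (e₂ * (-q * z₁ + p * z₂))) ^ 2 +
      (q * (e₁ * (p * z₁ + q * z₂)) + p * (e₂ * (-q * z₁ + p * z₂))) ^ 2 =
      (e₁ * (p * z₁ + q * z₂)) ^ 2 + (e₂ * (-q * z₁ + p * z₂)) ^ 2 := by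
    linear_combination ((e₁ * (p * z₁ + q * z₂)) ^ 2 + (e₂ * (-q * z₁ + p * z₂)) ^ 2) * hpq
  have hw : (p * z₁ + q * z₂) ^ 2 + (-q * z₁ + p * z₂) ^ 2 = z₁ ^ 2 + z₂ ^ 2 := by
    linear_combination (z₁ ^ 2 + z₂ ^ 2) * hpq
  have hsq₁ : (1:ℝ) ≤ e₁ ^ 2 := one_le_pow₀ he₁
  have hsq₂ : (1:ℝ) ≤ e₂ ^ 2 := one_le_pow₀ he₂
  have hm₁ := mul_le_mul_of_nonneg_right hsq₁ (sq_nonneg (p * z₁ + q * z₂))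
  have hm₂ := mul_le_mul_of_nonneg_right hsq₂ (sq_nonneg (-q * z₁ + p * z₂))
  rw [one_mul, ← mul_pow] at hm₁ hm₂
  linarith [h1, hn, hw, hm₁, hm₂]

/-- **One transport step is bounded.** If `|Cz|² ≤ B|z|²` and `N` is as above with `0 ≤ e₁, e₂ ≤ e`, then
`|C N z|² ≤ B e² |z|²`. -/
theorem transport_step_bounded {c₁₁ c₁₂ c₂₁ c₂₂ p q e₁ e₂ e B : ℝ} (hpq : p ^ 2 + q ^ 2 = 1) (he₁ : 0 ≤ e₁)
    (he₂ : 0 ≤ e₂) (h₁ : e₁ ≤ e) (h₂ : e₂ ≤ e) (hB : 0 ≤ B)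
    (hC : ∀ z₁ z₂ : ℝ, (c₁₁ * z₁ + c₁₂ * z₂) ^ 2 + (c₂₁ * z₁ + c₂₂ * z₂) ^ 2 ≤ B * (z₁ ^ 2 + z₂ ^ 2)) (z₁ z₂ : ℝ) :
    ((c₁₁ * (p ^ 2 * e₁ + q ^ 2 * e₂) + c₁₂ * (p * q * (e₁ - e₂))) * z₁ +
          (c₁₁ * (p * q * (e₁ - e₂)) + c₁₂ * (q ^ 2 * e₁ + p ^ 2 * e₂)) * z₂) ^ 2 +
        ((c₂₁ * (p ^ 2 * e₁ + q ^ 2 * e₂) + c₂₂ * (p * q * (e₁ - e₂))) * z₁ +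
          (c₂₁ * (p * q * (e₁ - e₂)) + c₂₂ * (q ^ 2 * e₁ + p ^ 2 * e₂)) * z₂) ^ 2 ≤
      B * e ^ 2 * (z₁ ^ 2 + z₂ ^ 2) := by
  have key : ∀ a b : ℝ, (a * (p ^ 2 * e₁ + q ^ 2 * e₂) + b * (p * q * (e₁ - e₂))) * z₁ +
      (a * (p * q * (e₁ - e₂)) + b * (q ^ 2 * e₁ + p ^ 2 * e₂)) * z₂ =
      a * (p * (e₁ * (p * z₁ + q * z₂)) - q * (e₂ * (-q * z₁ + p * z₂))) +
        b * (q * (e₁ * (p * z₁ + q * z₂)) + p * (e₂ * (-q * z₁ + p * z₂))) := by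
    intro a b; ring
  rw [key, key]
  have h1 := hC (p * (e₁ * (p * z₁ + q * z₂)) - q * (e₂ * (-q * z₁ + p * z₂)))
    (q * (e₁ * (p * z₁ + q * z₂)) + p * (e₂ * (-q * z₁ + p * z₂)))
  have hn : (p * (e₁ * (p * z₁ + q * z₂)) - q * (e₂ * (-q * z₁ + p * z₂))) ^ 2 +
      (q * (e₁ * (p * z₁ + q * z₂)) + p * (e₂ * (-q * z₁ + p * z₂))) ^ 2 =
      (e₁ * (p * z₁ + q * z₂)) ^ 2 + (e₂ * (-q * z₁ + p * z₂)) ^ 2 := by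
    linear_combination ((e₁ * (p * z₁ + q * z₂)) ^ 2 + (e₂ * (-q * z₁ + p * z₂)) ^ 2) * hpq
  have hw : (p * z₁ + q * z₂) ^ 2 + (-q * z₁ + p * z₂) ^ 2 = z₁ ^ 2 + z₂ ^ 2 := by
    linear_combination (z₁ ^ 2 + z₂ ^ 2) * hpq
  have hm₁ : (e₁ * (p * z₁ + q * z₂)) ^ 2 ≤ e ^ 2 * (p * z₁ + q * z₂) ^ 2 := by
    rw [mul_pow]; exact mul_le_mul_of_nonneg_right (pow_le_pow_left₀ he₁ h₁ 2) (sq_nonneg _)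
  have hm₂ : (e₂ * (-q * z₁ + p * z₂)) ^ 2 ≤ e ^ 2 * (-q * z₁ + p * z₂) ^ 2 := by
    rw [mul_pow]; exact mul_le_mul_of_nonneg_right (pow_le_pow_left₀ he₂ h₂ 2) (sq_nonneg _)
  have hm : (e₁ * (p * z₁ + q * z₂)) ^ 2 + (e₂ * (-q * z₁ + p * z₂)) ^ 2 ≤ e ^ 2 * (z₁ ^ 2 + z₂ ^ 2) := by
    rw [← hw]; linarith [hm₁, hm₂]
  have h2 := mul_le_mul_of_nonneg_left hm hB
  rw [hn] at h1
  linarith [h1, h2]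

/-- **Rotations preserve the norm**: `|R x|² = |x|²` for `R = [[p, q],[−q, p]]`, `p² + q² = 1`, complex entries. -/
theorem rot_norm_sq (p q : ℝ) (hpq : p ^ 2 + q ^ 2 = 1) (x₁ x₂ : ℂ) :
    ‖(p : ℂ) * x₁ + (q : ℂ) * x₂‖ ^ 2 + ‖-(q : ℂ) * x₁ + (p : ℂ) * x₂‖ ^ 2 = ‖x₁‖ ^ 2 + ‖x₂‖ ^ 2 := by
  simp only [Complex.sq_norm, Complex.normSq_apply, Complex.add_re, Complex.add_im, Complex.mul_re, Complex.mul_im,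
    Complex.ofReal_re, Complex.ofReal_im, Complex.neg_re, Complex.neg_im]
  nlinarith [hpq]

end Summit.AnomalousDissipation.AnomalousDissipation.Theorems.SolenoidalFractalHomogenisation.RealisedQuasiStaticCellLaw

end
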